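import Summits.NavierStokesRegularity.FluidComputer.PalasekTowerBoxSchedule
import Summits.NavierStokesRegularity.FluidComputer.PalasekTowerRegisterWindowTuned

/-!
# The BOX SCHEDULE AT ARBITRARY RATES `R`: a pinned, rigid, quiet schedule from ANY smooth force supported
# in a compact box — generic in the rates record, instantiated at `wide` (= `Schedule.ofBox`) and `tuned`

Cell `ns-blowup`, seat `ns-blowup-ecbridge-3` (g8); GROUP C «BRIDGE SUPPORT» of the route
`PalasekTowerBreakdown` after the RE-BASE (rev 19, 2026-08-27T10:23Z; live crux
`EpisodeBaseT := EpisodeBaseGAt TowerRates.tuned`, stmt-NavierStokesRegularity-20303). Sequel of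
`PalasekTowerBoxSchedule.lean` (g3, the box schedule on the wide-base rates) and of
`PalasekTowerRegisterWindowTuned.lean` (g8, the window arithmetic of `TowerRates.tuned`). LABEL: E–C typing
(KERNEL construction, generic; three definitions with body — the first window / first readout at `R` and
the box schedule at `R` — and their field lemmas). WHAT THIS IS NOT: not Navier–Stokes evidence — a
schedule (datum, force, clock, constants, ball) is written down from given data at given rates; no flow,
stage or tower is constructed and nothing is asserted about any dynamics or any crux.

## What and why (layer L1 of the door port, HANDOFF § ecbridge-3 g8)

Every level-`0` host design of the register needs the SAME schedule around its force, whatever the rates: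
the rigid window clock (`τ₀ = 1`, `τ_{k+1} = τ_k + 4bβ log N_{k+1}/A_k`, `T = 1 + Σ_k w_k`), the registered
constants `c₁ = 1`, `c₂ = 5/3`, `c₅ = 4bβ`, a push constant `c₄ ≤ 1`, and the clauses `Rigid`, `Quiet`
(force `= 0` from `τ₁` on) and `Pins 8 (6/5)`. `Schedule.ofBox` (g3) does this at `TowerRates.wide`, using
the wide numerics `wide_window_geo` / `wide_window_clock` / `wide_sep` inside. This file does it ONCE for
an arbitrary rates record `R`, taking the register numerics as HYPOTHESES in the shape of the generic window
schedule `Schedule.ofWindows`: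

* §1 `Host.wfirstAt R := R.window 0`, `Host.τfirstAt R := Schedule.windowTime R 1` (`= 1 + wfirstAt R`);
  at `R = wide` these are `Host.wfirst`, `Host.τfirst` (`rfl`);
* §2 `Schedule.ofBoxAt R c₃ r …` under `0 ≤ r < 1`, `w_{k+1} ≤ r w_k`, `A_k w_{k+1} ≤ (1 − r) c₃`,
  `2Y₀ ≤ Y₁`: datum `u₀` (smooth, compactly supported), force `F` (smooth on `ℝ × ℝ³`, compact space-time
  support, zero from `τfirstAt R` on, `‖F‖ ≤ c₄ Y₀(R)` on `[1, τfirstAt R]`), radius `ρ`, `c₄ ≤ 1`;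
* §3 field lemmas; `ofBoxAt_rigid`, `ofBoxAt_quiet`; **`ofBoxAt_pins`** (`Pins 8 (6/5)` given confinement,
  the band `2Y_k ≤ Y_{k+1}` and small windows `24 w_k ≤ 1` — `TowerRates.impulse_of_window_le`);
* §4 `ofBoxAt_wide` (at `R = wide`, `c₃ = 32`, `r = 1/3` the generic box schedule IS `Schedule.ofBox`,
  `rfl`) and **`Schedule.ofBoxTuned`** (at `R = tuned`, `c₃ = 128`, `r = 1/3`, numerics of
  `PalasekTowerRegisterWindowTuned`) with `ofBoxTuned_rigid` / `_quiet` / `_pins`.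

So a design seat proving `∃ S : Schedule tuned, S.Pins 8 (6/5) ∧ S.Rigid ∧ S.Quiet ∧ Nonempty (Stage …)`
from a host flow only has to produce the level-`0`/`1` STAGE; the schedule side at `tuned` is this file.

References: S. Palasek, arXiv:2605.13827 §3.3 (the schedule of switching times) [cite: Palasek2026ElementaryModel, §3.3];
C. L. Fefferman, Clay problem description, (4)–(6) [cite: FeffermanClay2006, (4) (5) (6)].
-/

noncomputable section

namespace Summit.NavierStokesRegularity.FluidComputer.PalasekTowerClayBridge

open Real Set Function Filter Topology Metric
open scoped ContDiff Topology ENNReal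

open Literature.Analysis.FluidPDE

/-! ## §1 The first window and the first readout at arbitrary rates -/

namespace Host

/-- **The first growth window at the rates `R`**: `w₀(R) = 4bβ log N₁ / A₀`. [folklore] -/
def wfirstAt (R : TowerRates) : ℝ := R.window 0

/-- **The first grown readout at the rates `R`**: `τ₁(R) = 1 + w₀(R)`. [folklore] -/
def τfirstAt (R : TowerRates) : ℝ := Schedule.windowTime R 1

variable (R : TowerRates)

/-- `0 < w₀(R)`. [folklore] -/
theorem wfirstAt_pos : 0 < wfirstAt R := R.window_pos 0

/-- `τ₁(R) = 1 + w₀(R)`. [folklore] -/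
theorem τfirstAt_eq : τfirstAt R = 1 + wfirstAt R := by
  simp [τfirstAt, wfirstAt, Schedule.windowTime]

/-- `1 < τ₁(R)`. [folklore] -/
theorem one_lt_τfirstAt : 1 < τfirstAt R := by
  rw [τfirstAt_eq]; linarith [wfirstAt_pos R]

/-- `windowTime R 0 = 1`. [folklore] -/
theorem windowTimeAt_zero : Schedule.windowTime R 0 = 1 := by
  simp [Schedule.windowTime]

/-- The readout times of the window clock are monotone in the level. [folklore] -/
theorem windowTimeAt_mono : Monotone (Schedule.windowTime R) := by
  refine monotone_nat_of_le_succ fun k => ?_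
  rw [Schedule.windowTime_succ]
  have := R.window_pos k
  linarith

/-- At `R = wide`: `wfirstAt wide = Host.wfirst`. [folklore] -/
theorem wfirstAt_wide : wfirstAt TowerRates.wide = wfirst := rfl

/-- At `R = wide`: `τfirstAt wide = Host.τfirst`. [folklore] -/
theorem τfirstAt_wide : τfirstAt TowerRates.wide = τfirst := rfl

end Host

/-! ## §2 The box schedule at arbitrary rates -/

section Generic

variable {R : TowerRates} {c₃ r : ℝ}

/-- Every readout time lies strictly before the blow-up time `T = 1 + Σ_k w_k` of the window clock, under
geometric domination of the windows. [folklore] -/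
theorem windowTime_lt_T_of_geo (hr0 : 0 ≤ r) (hr1 : r < 1)
    (hgeo : ∀ k, R.window (k + 1) ≤ r * R.window k) (k : ℕ) :
    Schedule.windowTime R k < 1 + ∑' j, R.window j := by
  have hs := (Schedule.window_tail_le hr0 hr1 hgeo 0).1
  simp only [add_zero] at hs
  have hsplit := hs.sum_add_tsum_nat_add k
  have htail := (Schedule.window_tail_le hr0 hr1 hgeo k).1
  have hpos : 0 < ∑' i, R.window (i + k) := by
    have h1 : R.window (0 + k) ≤ ∑' i, R.window (i + k) :=
      htail.le_tsum 0 (fun j _ => (R.window_pos (j + k)).le)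
    have h2 := R.window_pos (0 + k)
    linarith
  unfold Schedule.windowTime
  linarith

/-- The Palasek clock of the window schedule under the clock witness: `T − τ_{k+1} ≤ c₃ / A_k`.
[folklore] -/
theorem T_sub_windowTime_le_of_clock (hr0 : 0 ≤ r) (hr1 : r < 1)
    (hgeo : ∀ k, R.window (k + 1) ≤ r * R.window k)
    (hclock : ∀ k, R.A k * R.window (k + 1) ≤ (1 - r) * c₃) (k : ℕ) :
    (1 + ∑' j, R.window j) - Schedule.windowTime R (k + 1) ≤ c₃ / R.A k := by
  have hs := (Schedule.window_tail_le hr0 hr1 hgeo 0).1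
  simp only [add_zero] at hs
  have hsplit := hs.sum_add_tsum_nat_add (k + 1)
  obtain ⟨_, htail⟩ := Schedule.window_tail_le hr0 hr1 hgeo (k + 1)
  have hA : 0 < R.A k := R.A_pos k
  have h1r : 0 < 1 - r := by linarith
  have hwk : R.window (k + 1) / (1 - r) ≤ c₃ / R.A k := by
    rw [div_le_div_iff₀ h1r hA]
    have := hclock k
    nlinarith
  unfold Schedule.windowTime
  linarith

end Generic

/-- **THE BOX SCHEDULE AT THE RATES `R`**: the rigid window clock (`τ₀ = 1`, clock witness `c₃`), the
registered constants `c₁ = 1`, `c₂ = 5/3`, `c₅ = 4bβ`, push constant `c₄ ≤ 1`, radius `ρ`, the DATUM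
`u₀` (smooth, compactly supported) and the FORCE `F` (smooth on `ℝ × ℝ³`, compact space-time support,
zero from `τ₁(R)` on, `‖F‖ ≤ c₄ Y₀(R)` on the first window `[1, τ₁(R)]`), under the register numerics of
`R` taken as hypotheses (`w_{k+1} ≤ r w_k`, `A_k w_{k+1} ≤ (1 − r)c₃`, `2Y₀ ≤ Y₁`). Label loops and
scheduled circulations are constants. [cite: Palasek2026ElementaryModel, §3.3] -/
def Schedule.ofBoxAt (R : TowerRates) (c₃ r : ℝ) (hr0 : 0 ≤ r) (hr1 : r < 1)
    (hgeo : ∀ k, R.window (k + 1) ≤ r * R.window k)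
    (hclock : ∀ k, R.A k * R.window (k + 1) ≤ (1 - r) * c₃) (hsep : 2 * R.Y 0 ≤ R.Y 1)
    (u₀ : EuclideanSpace ℝ (Fin 3) → EuclideanSpace ℝ (Fin 3))
    (F : ℝ → EuclideanSpace ℝ (Fin 3) → EuclideanSpace ℝ (Fin 3)) (ρ c₄ : ℝ) (hc₄ : c₄ ≤ 1)
    (hu₀ : ContDiff ℝ ∞ u₀) (hu₀c : HasCompactSupport u₀)
    (hF : ContDiff ℝ ∞ (uncurry F)) (hFc : HasCompactSupport (uncurry F))
    (hFT : ∀ t, Host.τfirstAt R ≤ t → ∀ x, F t x = 0)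
    (hpush : ∀ t ∈ Icc (1 : ℝ) (Host.τfirstAt R), ∀ x, ‖F t x‖ ≤ c₄ * R.Y 0) :
    Schedule R where
  T := 1 + ∑' k, R.window k
  τ := Schedule.windowTime R
  τ_zero_pos := by rw [Host.windowTimeAt_zero]; exact one_pos
  τ_lt_succ := fun k => by
    rw [Schedule.windowTime_succ]
    have := R.window_pos k
    linarith
  τ_lt_T := windowTime_lt_T_of_geo hr0 hr1 hgeo
  c₁ := 1
  c₂ := 5 / 3
  c₃ := c₃
  c₄ := c₄
  c₅ := 4 * R.b * R.β
  c₁_pos := one_pos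
  c₄_le := hc₄
  c₅_le := le_rfl
  gap := by
    have hY0 : 0 < R.Y 0 := Real.rpow_pos_of_pos (R.N_pos 0) _
    linarith
  radius := ρ
  clock := T_sub_windowTime_le_of_clock hr0 hr1 hgeo hclock
  u₀ := u₀
  datum_decay := HasRapidSpatialDecay.of_hasCompactSupport hu₀ hu₀c
  f := F
  force_smooth := isSmoothOnHalfSpace_of_contDiff hF
  force_decay := hasRapidSpaceTimeDecay_of_hasCompactSupport hF hFc
  force_silent := fun t ht x =>
    hFT t ((windowTime_lt_T_of_geo hr0 hr1 hgeo 1).le.trans ht) x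
  push_small := by
    intro k t ht x
    rcases Nat.eq_zero_or_pos k with hk | hk
    · subst hk
      rw [Host.windowTimeAt_zero] at ht
      exact hpush t ⟨ht.1, ht.2⟩ x
    · have h1 : Host.τfirstAt R ≤ t := le_trans (Host.windowTimeAt_mono R hk) ht.1
      rw [hFT t h1 x, norm_zero]
      have hY : 0 < R.Y k := Real.rpow_pos_of_pos (R.N_pos k) _
      have hc0 : 0 ≤ c₄ := by
        have h := hpush 1 ⟨le_rfl, (Host.one_lt_τfirstAt R).le⟩ 0
        have hY0 : 0 < R.Y 0 := Real.rpow_pos_of_pos (R.N_pos 0) _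
        nlinarith [norm_nonneg (F 1 0)]
      positivity
  loop := fun _ _ => 0
  loop_smooth := fun _ => contDiff_const
  loop_closed := fun _ => rfl
  Φ := fun _ => 1
  Φ_pos := fun _ => one_pos

/-! ## §3 Field lemmas and the register clauses -/

namespace Schedule

section OfBoxAt

variable {R : TowerRates} {c₃ r : ℝ} (hr0 : 0 ≤ r) (hr1 : r < 1)
  (hgeo : ∀ k, R.window (k + 1) ≤ r * R.window k)
  (hclock : ∀ k, R.A k * R.window (k + 1) ≤ (1 - r) * c₃) (hsep : 2 * R.Y 0 ≤ R.Y 1)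
  {u₀ : EuclideanSpace ℝ (Fin 3) → EuclideanSpace ℝ (Fin 3)}
  {F : ℝ → EuclideanSpace ℝ (Fin 3) → EuclideanSpace ℝ (Fin 3)} {ρ c₄ : ℝ} (hc₄ : c₄ ≤ 1)
  (hu₀ : ContDiff ℝ ∞ u₀) (hu₀c : HasCompactSupport u₀)
  (hF : ContDiff ℝ ∞ (uncurry F)) (hFc : HasCompactSupport (uncurry F))
  (hFT : ∀ t, Host.τfirstAt R ≤ t → ∀ x, F t x = 0)
  (hpush : ∀ t ∈ Icc (1 : ℝ) (Host.τfirstAt R), ∀ x, ‖F t x‖ ≤ c₄ * R.Y 0)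

/-- The force of the box schedule is `F`. [folklore] -/
theorem ofBoxAt_f :
    (ofBoxAt R c₃ r hr0 hr1 hgeo hclock hsep u₀ F ρ c₄ hc₄ hu₀ hu₀c hF hFc hFT hpush).f = F := rfl

/-- The datum of the box schedule is `u₀`. [folklore] -/
theorem ofBoxAt_u₀ :
    (ofBoxAt R c₃ r hr0 hr1 hgeo hclock hsep u₀ F ρ c₄ hc₄ hu₀ hu₀c hF hFc hFT hpush).u₀ = u₀ := rfl

/-- The readouts of the box schedule are the window clock of `R`. [folklore] -/
theorem ofBoxAt_τ :
    (ofBoxAt R c₃ r hr0 hr1 hgeo hclock hsep u₀ F ρ c₄ hc₄ hu₀ hu₀c hF hFc hFT hpush).τ =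
      Schedule.windowTime R := rfl

/-- `τ 0 = 1`. [folklore] -/
theorem ofBoxAt_τ_zero :
    (ofBoxAt R c₃ r hr0 hr1 hgeo hclock hsep u₀ F ρ c₄ hc₄ hu₀ hu₀c hF hFc hFT hpush).τ 0 = 1 :=
  Host.windowTimeAt_zero R

/-- `τ 1 = τ₁(R)`. [folklore] -/
theorem ofBoxAt_τ_one :
    (ofBoxAt R c₃ r hr0 hr1 hgeo hclock hsep u₀ F ρ c₄ hc₄ hu₀ hu₀c hF hFc hFT hpush).τ 1 =
      Host.τfirstAt R := rfl

/-- The blow-up time of the box schedule. [folklore] -/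
theorem ofBoxAt_T :
    (ofBoxAt R c₃ r hr0 hr1 hgeo hclock hsep u₀ F ρ c₄ hc₄ hu₀ hu₀c hF hFc hFT hpush).T =
      1 + ∑' k, R.window k := rfl

/-- The radius of the box schedule is `ρ`. [folklore] -/
theorem ofBoxAt_radius :
    (ofBoxAt R c₃ r hr0 hr1 hgeo hclock hsep u₀ F ρ c₄ hc₄ hu₀ hu₀c hF hFc hFT hpush).radius = ρ := rfl

/-- `c₁ = 1`. [folklore] -/
theorem ofBoxAt_c₁ :
    (ofBoxAt R c₃ r hr0 hr1 hgeo hclock hsep u₀ F ρ c₄ hc₄ hu₀ hu₀c hF hFc hFT hpush).c₁ = 1 := rfl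

/-- `c₂ = 5/3`. [folklore] -/
theorem ofBoxAt_c₂ :
    (ofBoxAt R c₃ r hr0 hr1 hgeo hclock hsep u₀ F ρ c₄ hc₄ hu₀ hu₀c hF hFc hFT hpush).c₂ = 5 / 3 := rfl

/-- The push constant is the prescribed `c₄`. [folklore] -/
theorem ofBoxAt_c₄ :
    (ofBoxAt R c₃ r hr0 hr1 hgeo hclock hsep u₀ F ρ c₄ hc₄ hu₀ hu₀c hF hFc hFT hpush).c₄ = c₄ := rfl

/-- `c₅ = 4bβ`. [folklore] -/
theorem ofBoxAt_c₅ :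
    (ofBoxAt R c₃ r hr0 hr1 hgeo hclock hsep u₀ F ρ c₄ hc₄ hu₀ hu₀c hF hFc hFT hpush).c₅ =
      4 * R.b * R.β := rfl

/-- **RIGID** (window equality, `c₅ = 4bβ`, `c₁ = 1`, `c₂ = 5/3` — by construction). [folklore] -/
theorem ofBoxAt_rigid :
    (ofBoxAt R c₃ r hr0 hr1 hgeo hclock hsep u₀ F ρ c₄ hc₄ hu₀ hu₀c hF hFc hFT hpush).Rigid where
  window_eq := fun k => by
    show Schedule.windowTime R (k + 1) = Schedule.windowTime R k +
      4 * R.b * R.β * Real.log (R.N (k + 1)) / R.A k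
    rw [Schedule.windowTime_succ]
    rfl
  c₅_eq := rfl
  c₁_eq := rfl
  c₂_eq := rfl

/-- **QUIET** (the force vanishes from `τ 1 = τ₁(R)` on). [folklore] -/
theorem ofBoxAt_quiet :
    (ofBoxAt R c₃ r hr0 hr1 hgeo hclock hsep u₀ F ρ c₄ hc₄ hu₀ hu₀c hF hFc hFT hpush).Quiet := by
  intro t ht
  funext x
  exact hFT t ht x

/-- **PINNED** with `Λ = 8`, `θ = 6/5`, as soon as datum and force are confined to `B̄(0, ρ)`, the rates
afford the band `2Y_k ≤ Y_{k+1}` at every level and the windows are small (`24 w_k ≤ 1`, so that the push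
`8 c₄ Y_k w_k ≤ Y_k/3` never competes with the jump `Y_{k+1} − (5/3)Y_k ≥ Y_k/3`). [folklore] -/
theorem ofBoxAt_pins (hsep' : ∀ k, 2 * R.Y k ≤ R.Y (k + 1)) (hw : ∀ k, 24 * R.window k ≤ 1)
    (hu₀ρ : ∀ x, ρ < ‖x‖ → u₀ x = 0) (hFρ : ∀ t x, ρ < ‖x‖ → F t x = 0) :
    (ofBoxAt R c₃ r hr0 hr1 hgeo hclock hsep u₀ F ρ c₄ hc₄ hu₀ hu₀c hF hFc hFT hpush).Pins 8 (6 / 5) where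
  impulse := fun k => by
    show 8 * (c₄ * R.Y k) * (Schedule.windowTime R (k + 1) - Schedule.windowTime R k) ≤
      1 * R.Y (k + 1) - 5 / 3 * R.Y k
    rw [Schedule.windowTime_succ, add_sub_cancel_left]
    exact R.impulse_of_window_le (hsep' k) (hw k) hc₄
  sep := fun k => by
    show 6 / 5 * (5 / 3 * R.Y k) ≤ 1 * R.Y (k + 1)
    have := hsep' k
    linarith
  datum_confined := fun x hx => hu₀ρ x hx
  force_confined := fun t x hx => hFρ t x hx

end OfBoxAt

/-! ## §4 The instances: `wide` (the box schedule of record) and `tuned` -/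

section Wide

variable {u₀ : EuclideanSpace ℝ (Fin 3) → EuclideanSpace ℝ (Fin 3)}
  {F : ℝ → EuclideanSpace ℝ (Fin 3) → EuclideanSpace ℝ (Fin 3)} {ρ c₄ : ℝ} (hc₄ : c₄ ≤ 1)
  (hu₀ : ContDiff ℝ ∞ u₀) (hu₀c : HasCompactSupport u₀)
  (hF : ContDiff ℝ ∞ (uncurry F)) (hFc : HasCompactSupport (uncurry F))
  (hFT : ∀ t, Host.τfirst ≤ t → ∀ x, F t x = 0)
  (hpush : ∀ t ∈ Icc (1 : ℝ) Host.τfirst, ∀ x, ‖F t x‖ ≤ c₄ * TowerRates.wide.Y 0)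

/-- **At `R = wide` the generic box schedule (`c₃ = 32`, `r = 1/3`, wide numerics) IS `Schedule.ofBox`.**
[folklore] -/
theorem ofBoxAt_wide :
    ofBoxAt TowerRates.wide 32 (1 / 3) (by norm_num) (by norm_num) TowerRates.wide_window_geo
      TowerRates.wide_window_clock (TowerRates.wide_sep 0) u₀ F ρ c₄ hc₄ hu₀ hu₀c hF hFc hFT hpush =
    ofBox u₀ F ρ c₄ hc₄ hu₀ hu₀c hF hFc hFT hpush := rfl

end Wide

section Tuned

variable (u₀ : EuclideanSpace ℝ (Fin 3) → EuclideanSpace ℝ (Fin 3))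
  (F : ℝ → EuclideanSpace ℝ (Fin 3) → EuclideanSpace ℝ (Fin 3)) (ρ c₄ : ℝ) (hc₄ : c₄ ≤ 1)
  (hu₀ : ContDiff ℝ ∞ u₀) (hu₀c : HasCompactSupport u₀)
  (hF : ContDiff ℝ ∞ (uncurry F)) (hFc : HasCompactSupport (uncurry F))
  (hFT : ∀ t, Host.τfirstAt TowerRates.tuned ≤ t → ∀ x, F t x = 0)
  (hpush : ∀ t ∈ Icc (1 : ℝ) (Host.τfirstAt TowerRates.tuned), ∀ x, ‖F t x‖ ≤ c₄ * TowerRates.tuned.Y 0)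

/-- **THE BOX SCHEDULE ON THE TUNED RATES** (`c₃ = 128`, `r = 1/3`; numerics `tuned_window_geo`,
`tuned_window_clock`, `tuned_sep`). [cite: Palasek2026ElementaryModel, §3.3] -/
def ofBoxTuned : Schedule TowerRates.tuned :=
  ofBoxAt TowerRates.tuned 128 (1 / 3) (by norm_num) (by norm_num) TowerRates.tuned_window_geo
    TowerRates.tuned_window_clock (TowerRates.tuned_sep 0) u₀ F ρ c₄ hc₄ hu₀ hu₀c hF hFc hFT hpush

variable {u₀ F ρ c₄}

/-- The tuned box schedule is RIGID. [folklore] -/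
theorem ofBoxTuned_rigid : (ofBoxTuned u₀ F ρ c₄ hc₄ hu₀ hu₀c hF hFc hFT hpush).Rigid :=
  ofBoxAt_rigid _ _ _ _ _ hc₄ hu₀ hu₀c hF hFc hFT hpush

/-- The tuned box schedule is QUIET. [folklore] -/
theorem ofBoxTuned_quiet : (ofBoxTuned u₀ F ρ c₄ hc₄ hu₀ hu₀c hF hFc hFT hpush).Quiet :=
  ofBoxAt_quiet _ _ _ _ _ hc₄ hu₀ hu₀c hF hFc hFT hpush

/-- **The tuned box schedule is PINNED with `Λ = 8`, `θ = 6/5`** as soon as datum and force are confined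
to `B̄(0, ρ)` (`tuned_sep`, `tuned_window_le`). [folklore] -/
theorem ofBoxTuned_pins (hu₀ρ : ∀ x, ρ < ‖x‖ → u₀ x = 0) (hFρ : ∀ t x, ρ < ‖x‖ → F t x = 0) :
    (ofBoxTuned u₀ F ρ c₄ hc₄ hu₀ hu₀c hF hFc hFT hpush).Pins 8 (6 / 5) :=
  ofBoxAt_pins _ _ _ _ _ hc₄ hu₀ hu₀c hF hFc hFT hpush TowerRates.tuned_sep TowerRates.tuned_window_le
    hu₀ρ hFρ

/-- Field lemmas of the tuned box schedule: force, datum, readouts, radius. [folklore] -/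
theorem ofBoxTuned_fields :
    (ofBoxTuned u₀ F ρ c₄ hc₄ hu₀ hu₀c hF hFc hFT hpush).f = F ∧
    (ofBoxTuned u₀ F ρ c₄ hc₄ hu₀ hu₀c hF hFc hFT hpush).u₀ = u₀ ∧
    (ofBoxTuned u₀ F ρ c₄ hc₄ hu₀ hu₀c hF hFc hFT hpush).τ 0 = 1 ∧
    (ofBoxTuned u₀ F ρ c₄ hc₄ hu₀ hu₀c hF hFc hFT hpush).τ 1 = Host.τfirstAt TowerRates.tuned ∧
    (ofBoxTuned u₀ F ρ c₄ hc₄ hu₀ hu₀c hF hFc hFT hpush).radius = ρ :=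
  ⟨rfl, rfl, Host.windowTimeAt_zero _, rfl, rfl⟩

end Tuned

end Schedule

end Summit.NavierStokesRegularity.FluidComputer.PalasekTowerClayBridge

end
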